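import Summits.CriticalPhenomena.PercolationContinuityZ3.Theorems.SahiConjectureProduct
import Literature.Combinatorics.Sahi2008.GeneratingFunction

/-!
# Sahi's Conjecture 4 (the generating-function form) — the obligation, and its equivalence with
# the hierarchy `∀ n, C_n` (Lieb–Sahi 2022, Theorem 4.4)

Companion of `SahiConjecture.lean` (cell `prim-sahi`, typer; `--supports stmt-CriticalPhenomena-4575`).
Sahi [Sahi2008, p. 209] packages the inequalities `E_n ≥ 0` for ALL `n` into one positivity statement in
`ℝ⟦t⟧` — Conjecture 4: `1 - ∏_{S ⊆ X} (1 - F(S))^{μ(S)} ∈ 𝒫` for `F ∈ ℐ[X]` and `μ` FKG — and shows it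
implies Conjecture 5 (`E_n ≥ 0`) by the prime specialisation trick; Lieb–Sahi [LiebSahi2021, Thm. 4.4]
prove the converse.  The tree now has the power series (`Literature.Combinatorics.Sahi2008.sahiSeries μ f`,
Mathlib's `PowerSeries.binomialSeries` for the real powers) and Theorem 4.4 weight by weight
(`Literature.Combinatorics.Sahi2008.forall_sahiPositive_iff_sahiSeries`,
`Literature/Combinatorics/Sahi2008/GeneratingFunction.lean`).  By the tree's placement rule the conjecture
itself is stated HERE as the `@[conjecture]` obligation `SahiGFConjecture`, and this file proves

* `sahiGFConjecture_iff_forall_sahiConjecture : SahiGFConjecture ↔ ∀ n, SahiConjecture n` — Sahi's two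
  conjectures are one obligation (so every typed form of the hierarchy in this directory — FKG posets,
  product cubes, uniform cubes, Sahi's verbatim `2^X` — has the generating-function form too);
* `sahiGFConjecture_iff_forall_set` — Sahi's verbatim `2^X` setting is equivalent to Lieb–Sahi's FKG-poset
  setting;
* `sahiGFConjecture_le_sahiConjecture n`, `sahiGFConjecture_le_kahnConjecture` (heads `≤` on `Prop`).

What is PROVED unconditionally lives in the Literature file: Sahi's Theorem 1 (product measures, `𝒞[X]`),
Proposition 15 verbatim (`|X| ≤ 2`), Blinovsky's FKG cumulations, chains, and Lieb–Sahi's unit square,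
all in power-series form.  Nothing here asserts `SahiGFConjecture` or `SahiConjecture n` (both
`[status: open]`; [LiebSahi2021, p. 3; DubeySahi2025, footnote 6]).
-/

noncomputable section

namespace Summit.CriticalPhenomena.PercolationContinuityZ3.Theorems

open Literature.Combinatorics.Sahi2008

/-- **Sahi's Conjecture 4** [Sahi2008, p. 212, verbatim: "For any `F` in `ℐ[X]`, and any `μ` satisfying
(8), we have `1 - ∏_{S ⊆ X} (1 - F(S))^{μ(S)} ∈ 𝒫`"] = Lieb–Sahi's Conjecture 1.2 (the power series
`1 - exp(𝔼 log(1 - Σ_i f_i t^i))` has positive coefficients), in the tree's vocabulary: for every finite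
distributive lattice `α : Type`, every FKG probability weight `μ` on `α` and every sequence of
nonnegative monotone functions `f_1, f_2, …` (the coefficient functions of `F ∈ ℐ[X]`; `f 0` is ignored),
every coefficient of `Literature.Combinatorics.Sahi2008.sahiSeries μ f = 1 - ∏_x (1 - Σ_{i≥1} f_i(x)t^i)^{μ(x)}`
is nonnegative.  (Sahi states it on `2^X`; the FKG-poset generality is Lieb–Sahi's and costs nothing,
`sahiGFConjecture_iff_forall_set`.)  OPEN; an obligation / hypothesis of our theories, equivalent to
`∀ n, SahiConjecture n` (`sahiGFConjecture_iff_forall_sahiConjecture`).  Never import as a fact.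
[cite: Sahi2008, Conj. 4 (p. 212); LiebSahi2021, Conj. 1.2] [status: open] -/
@[conjecture] def SahiGFConjecture : Prop :=
  ∀ (α : Type) [DistribLattice α] [Fintype α] (μ : α → ℝ), IsFKGMeasure μ →
    ∀ f : ℕ → α → ℝ, (∀ i x, 0 ≤ f i x) → (∀ i, Monotone (f i)) →
      ∀ M : ℕ, 0 ≤ PowerSeries.coeff M (sahiSeries μ f)

/-- **Sahi's Conjecture 4 ⟺ Conjecture 5 for every `n`** [Sahi2008, p. 212: "this implies the
following"; LiebSahi2021, Thm. 4.4: "Conjectures (1.1) and (1.2) are equivalent"]: the generating-function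
obligation is equivalent to the full hierarchy `∀ n, SahiConjecture n` — weight by weight this is the
tree theorem `Literature.Combinatorics.Sahi2008.forall_sahiPositive_iff_sahiSeries` (Prop. 12 polarised +
Sahi's prime specialisation trick).  Head `↔` between two open obligations; neither side is asserted.
[cite: LiebSahi2021, Thm. 4.4 (Appendix); Sahi2008, p. 212 and §3.2 (pp. 220–221)] -/
theorem sahiGFConjecture_iff_forall_sahiConjecture : SahiGFConjecture ↔ ∀ n, SahiConjecture n := by
  constructor
  · intro h n α _ _ μ hμ
    exact (forall_sahiPositive_iff_sahiSeries μ hμ.sum_eq_one).2 (h α μ hμ) n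
  · intro h α _ _ μ hμ
    exact (forall_sahiPositive_iff_sahiSeries μ hμ.sum_eq_one).1 (fun n => h n α μ hμ)

/-- **Sahi's verbatim setting costs nothing:** the obligation over all FKG posets is equivalent to its
restriction to the Boolean lattices `2^X` with an FKG weight [Sahi2008, Conj. 4 as printed] (through
`sahiConjecture_iff_forall_set`: both hierarchies collapse to product / Boolean-lattice weights since FKG
measures are FUI). [cite: Sahi2008, Conj. 4 (p. 212); LiebSahi2021, Conj. 1.2 and Thm. 4.4; Kahn2022, p. 3] -/
theorem sahiGFConjecture_iff_forall_set :
    SahiGFConjecture ↔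
      ∀ (X : Type) [Fintype X] (μ : Set X → ℝ), IsFKGMeasure μ →
        ∀ f : ℕ → Set X → ℝ, (∀ i ω, 0 ≤ f i ω) → (∀ i, Monotone (f i)) →
          ∀ M : ℕ, 0 ≤ PowerSeries.coeff M (sahiSeries μ f) := by
  constructor
  · intro h X _ μ hμ
    exact h (Set X) μ hμ
  · intro h
    rw [sahiGFConjecture_iff_forall_sahiConjecture]
    intro n
    rw [sahiConjecture_iff_forall_set]
    intro X _ μ hμ
    exact (forall_sahiPositive_iff_sahiSeries μ hμ.sum_eq_one).2 (h X μ hμ) n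

/-- The generating-function obligation implies each level of the hierarchy (in particular Kahn's
Conjecture 5 at `n = 3`), written with `≤` on `Prop`. [cite: LiebSahi2021, Thm. 4.4; Sahi2008, p. 212] -/
theorem sahiGFConjecture_le_sahiConjecture (n : ℕ) : SahiGFConjecture ≤ SahiConjecture n :=
  fun h => (sahiGFConjecture_iff_forall_sahiConjecture.1 h) n

/-- … and Kahn's Conjecture 5 (`n = 3`, product measures). [cite: Kahn2022, Conj. 5 (arXiv p. 3);
LiebSahi2021, Thm. 4.4] -/
theorem sahiGFConjecture_le_kahnConjecture : SahiGFConjecture ≤ KahnConjecture :=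
  fun h => sahiConjecture_three_iff_kahnConjecture.1 (sahiGFConjecture_le_sahiConjecture 3 h)

/-- **Generating-function form on product cubes**: the obligation is equivalent to "for every finite
product space `2^ι` with biases `p` and all nonnegative monotone `f_1, f_2, …`, every coefficient of
`1 - ∏_ω (1 - Σ_i f_i(ω)t^i)^{μ_p(ω)}` is nonnegative" (FKG measures are FUI:
`sahiConjecture_iff_forall_bernoulliWeight`, then Theorem 4.4 weight by weight).
[cite: Kahn2022, p. 3 (before Conj. 5); LiebSahi2021, Thm. 4.4; Sahi2008, Thm. 1 / Conj. 4 (pp. 210–212)] -/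
theorem sahiGFConjecture_iff_forall_bernoulliWeight :
    SahiGFConjecture ↔
      ∀ (ι : Type) [Fintype ι] (p : ι → unitInterval) (f : ℕ → Set ι → ℝ),
        (∀ i ω, 0 ≤ f i ω) → (∀ i, Monotone (f i)) →
          ∀ M : ℕ, 0 ≤ PowerSeries.coeff M (sahiSeries (bernoulliWeight p) f) := by
  rw [sahiGFConjecture_iff_forall_sahiConjecture, forall_sahiConjecture_iff_forall_bernoulliWeight]
  constructor
  · intro h ι _ p
    exact (forall_sahiPositive_iff_sahiSeries (bernoulliWeight p) (sum_bernoulliWeight p)).1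
      (fun n => h n ι p)
  · intro h n ι _ p
    exact (forall_sahiPositive_iff_sahiSeries (bernoulliWeight p) (sum_bernoulliWeight p)).2 (h ι p) n

end Summit.CriticalPhenomena.PercolationContinuityZ3.Theorems
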